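import Mathlib
import HarnessLib
import Summits.Langlands.Langlands.Theorems.TwistUnpackaging.Negative.ControlLoadBearing

/-!
# `TwistUnpackaging` (stmt-Langlands-10903) — Negative knowledge V: the determinant-rescue boundary

Berger–Harcos 2007 §6 / Mok 2014 Prop. 5.13 close the cofinite step at `n = 2` with quadratic
twists only (ratio `-1`, order `2 = n`, which does NOT separate: `not_separates_of_orderOf_le`,
`rank_two_neg_one_swap`) by adding the DETERMINANT (central character): `rank_two_det_rescue`.
How far does that rescue reach?
* `odd_part_eq`: the `ψ = 1` identity and the ratio-`-1` identity together say exactly that the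
  ODD PARTS agree, `X + S⁻ = S + X⁻` (`M⁻ = (-1)•M`), in every rank.
* `det_rescue_rank_three`: in rank `3` (non-zero eigenvalues) odd parts + determinant DO pin
  `X = S` — the rescue extends one rank beyond print (odd power sums `p₁, p₃, p₅` + `e₃ ≠ 0`
  recover `e₂` by Newton's identities).
* `not_detRescue_of_four_le`: from rank `4` on it FAILS: `X = {1,-1,6,-6}`, `S = {2,-2,3,-3}`
  (both `(-1)`-symmetric, equal determinants `36`), partners `X' = S`, `S' = X`; padding by a
  common eigenvalue gives every rank `≥ 4`. Unit-norm (pure) witnesses exist as well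
  (`X = {±1, ±i}`, `S = {±(3+4i)/5, ±(4+3i)/5}`, determinants `-1`): purity does not help.
So "quadratic twists + central character" is a rank-`≤ 3` device; the crux's general-`n`
extraction must use admissible twists of ratio order `> n` at the place (cf. Negative I, IV).
From the standing disprover's `Disproof.lean` (cdisprove gen 3, cycle 3). Mathlib-only. [folklore]
-/

namespace Summit.Langlands.Langlands.Theorems.TwistUnpackaging.Negative

open Multiset Polynomial

/-- `DetRescue n`: in rank `n`, the `ψ = 1` identity, the ratio-`-1` (quadratic twist) identity and
the DETERMINANTS pin `X = S` among data with non-zero eigenvalues. True for `n ≤ 3`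
(`rank_two_det_rescue`, `det_rescue_rank_three`), false for `n ≥ 4` (`not_detRescue_of_four_le`).
[folklore] -/
def DetRescue (n : ℕ) : Prop :=
  ∀ X X' S S' : Multiset ℂ, card X = n → card X' = n → card S = n → card S' = n →
    (0 : ℂ) ∉ X → (0 : ℂ) ∉ S →
    X + X' = S + S' → X + X'.map ((-1 : ℂ) * ·) = S + S'.map ((-1 : ℂ) * ·) →
    X.prod = S.prod → X'.prod = S'.prod → X = S

/-- **Odd parts.** The `ψ = 1` identity and the ratio-`-1` identity give `X + S⁻ = S + X⁻`
(equivalently: the signed defect `X - S` is an even measure), in every rank and with no side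
condition. This is ALL the two identities say about `(X, S)` (the partners `X', S'` can then be
solved for). [folklore] -/
theorem odd_part_eq (X X' S S' : Multiset ℂ) (h1 : X + X' = S + S')
    (h2 : X + X'.map ((-1 : ℂ) * ·) = S + S'.map ((-1 : ℂ) * ·)) :
    X + S.map ((-1 : ℂ) * ·) = S + X.map ((-1 : ℂ) * ·) := by
  ext z
  have hinj : Function.Injective (fun x : ℂ => (-1 : ℂ) * x) :=
    mul_right_injective₀ (by norm_num)
  have hc : ∀ M : Multiset ℂ, count z (M.map ((-1 : ℂ) * ·)) = count (-z) M := by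
    intro M
    have := count_map_eq_count' (fun x : ℂ => (-1 : ℂ) * x) M hinj (-z)
    simpa using this
  have e1 := congrArg (count (-z)) h1
  have e2 := congrArg (count z) h2
  simp only [count_add, hc] at e1 e2 ⊢
  omega

/-- **The rescue extends to rank 3.** Odd parts + determinant pin a `3`-multiset of NON-ZERO
complex numbers: the odd power sums `p₁, p₃, p₅` agree, Newton gives `3e₁(e₂-e₂') = 0` and
`(e₂-e₂')(e₁³ - e₁(e₂+e₂') + e₃) = 0`, so `e₂ ≠ e₂'` would force `e₁ = 0` and then `e₃ = 0`.
(No hypothesis on the partners `X', S'` beyond the two identities.) [folklore] -/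
theorem det_rescue_rank_three (X X' S S' : Multiset ℂ) (hX : card X = 3) (hS : card S = 3)
    (h0 : (0 : ℂ) ∉ X) (h1 : X + X' = S + S')
    (h2 : X + X'.map ((-1 : ℂ) * ·) = S + S'.map ((-1 : ℂ) * ·)) (hdet : X.prod = S.prod) :
    X = S := by
  have E := odd_part_eq X X' S S' h1 h2
  obtain ⟨x₁, x₂, x₃, rfl⟩ := Multiset.card_eq_three.1 hX
  obtain ⟨s₁, s₂, s₃, rfl⟩ := Multiset.card_eq_three.1 hS
  have hx₁ : x₁ ≠ 0 := by rintro rfl; simp at h0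
  have hx₂ : x₂ ≠ 0 := by rintro rfl; simp at h0
  have hx₃ : x₃ ≠ 0 := by rintro rfl; simp at h0
  -- odd power sums from the odd-part identity
  have hps : ∀ k : ℕ, x₁ ^ k + x₂ ^ k + x₃ ^ k + ((-s₁) ^ k + (-s₂) ^ k + (-s₃) ^ k) =
      s₁ ^ k + s₂ ^ k + s₃ ^ k + ((-x₁) ^ k + (-x₂) ^ k + (-x₃) ^ k) := by
    intro k
    have := congrArg (fun M : Multiset ℂ => (M.map (· ^ k)).sum) E
    simp only [Multiset.map_add, Multiset.sum_add, Multiset.insert_eq_cons, Multiset.map_cons,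
      Multiset.map_singleton, Multiset.sum_cons, Multiset.sum_singleton, neg_mul, one_mul] at this
    linear_combination this
  have k1 : x₁ + x₂ + x₃ = s₁ + s₂ + s₃ := by linear_combination (hps 1) / 2
  have k3 : x₁ ^ 3 + x₂ ^ 3 + x₃ ^ 3 = s₁ ^ 3 + s₂ ^ 3 + s₃ ^ 3 := by
    linear_combination (hps 3) / 2
  have k5 : x₁ ^ 5 + x₂ ^ 5 + x₃ ^ 5 = s₁ ^ 5 + s₂ ^ 5 + s₃ ^ 5 := by
    linear_combination (hps 5) / 2
  have hd : x₁ * (x₂ * x₃) = s₁ * (s₂ * s₃) := by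
    simpa [Multiset.insert_eq_cons] using hdet
  -- Newton: 3 e₁ (e₂ - e₂') = 0
  have A : (x₁ + x₂ + x₃) * ((x₁ * x₂ + x₁ * x₃ + x₂ * x₃) - (s₁ * s₂ + s₁ * s₃ + s₂ * s₃)) = 0 := by
    linear_combination
      (((x₁ + x₂ + x₃) ^ 2 + (x₁ + x₂ + x₃) * (s₁ + s₂ + s₃) + (s₁ + s₂ + s₃) ^ 2) / 3 -
          (s₁ * s₂ + s₁ * s₃ + s₂ * s₃)) * k1 + hd - (1 / 3 : ℂ) * k3
  -- Newton: (e₂ - e₂') (e₁³ - e₁ (e₂ + e₂') + e₃) = 0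
  have B : ((x₁ * x₂ + x₁ * x₃ + x₂ * x₃) - (s₁ * s₂ + s₁ * s₃ + s₂ * s₃)) *
      ((x₁ + x₂ + x₃) ^ 3 - (x₁ + x₂ + x₃) *
        ((x₁ * x₂ + x₁ * x₃ + x₂ * x₃) + (s₁ * s₂ + s₁ * s₃ + s₂ * s₃)) + x₁ * (x₂ * x₃)) = 0 := by
    linear_combination
      ((((x₁ + x₂ + x₃) ^ 4 + (x₁ + x₂ + x₃) ^ 3 * (s₁ + s₂ + s₃) +
            (x₁ + x₂ + x₃) ^ 2 * (s₁ + s₂ + s₃) ^ 2 + (x₁ + x₂ + x₃) * (s₁ + s₂ + s₃) ^ 3 +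
            (s₁ + s₂ + s₃) ^ 4) -
          5 * (s₁ * s₂ + s₁ * s₃ + s₂ * s₃) *
            ((x₁ + x₂ + x₃) ^ 2 + (x₁ + x₂ + x₃) * (s₁ + s₂ + s₃) + (s₁ + s₂ + s₃) ^ 2) +
          5 * (s₁ * s₂ + s₁ * s₃ + s₂ * s₃) ^ 2 +
          5 * (s₁ * (s₂ * s₃)) * ((x₁ + x₂ + x₃) + (s₁ + s₂ + s₃))) / 5) * k1 +
      ((5 * (x₁ + x₂ + x₃) ^ 2 - 5 * (s₁ * s₂ + s₁ * s₃ + s₂ * s₃)) / 5) * hd -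
      (1 / 5 : ℂ) * k5
  have he2 : x₁ * x₂ + x₁ * x₃ + x₂ * x₃ = s₁ * s₂ + s₁ * s₃ + s₂ * s₃ := by
    by_contra hne
    have hne' : (x₁ * x₂ + x₁ * x₃ + x₂ * x₃) - (s₁ * s₂ + s₁ * s₃ + s₂ * s₃) ≠ 0 :=
      sub_ne_zero.2 hne
    have he1 : x₁ + x₂ + x₃ = 0 := (mul_eq_zero.1 A).resolve_right hne'
    have hB := (mul_eq_zero.1 B).resolve_left hne'
    rw [he1] at hB
    have h3 : x₁ * (x₂ * x₃) = 0 := by linear_combination hB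
    exact mul_ne_zero hx₁ (mul_ne_zero hx₂ hx₃) h3
  -- same elementary symmetric functions ⇒ same polynomial ⇒ same roots
  have E1 : C x₁ + C x₂ + C x₃ = C s₁ + C s₂ + C s₃ := by simp only [← C_add, k1]
  have E2 : C x₁ * C x₂ + C x₁ * C x₃ + C x₂ * C x₃ =
      C s₁ * C s₂ + C s₁ * C s₃ + C s₂ * C s₃ := by simp only [← C_mul, ← C_add, he2]
  have E3 : C x₁ * (C x₂ * C x₃) = C s₁ * (C s₂ * C s₃) := by simp only [← C_mul, hd]
  have key : (({x₁, x₂, x₃} : Multiset ℂ).map fun a => X - C a).prod =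
      (({s₁, s₂, s₃} : Multiset ℂ).map fun a => X - C a).prod := by
    simp only [Multiset.insert_eq_cons, Multiset.map_cons, Multiset.map_singleton,
      Multiset.prod_cons, Multiset.prod_singleton]
    linear_combination (-(X : ℂ[X]) ^ 2) * E1 + (X : ℂ[X]) * E2 - E3
  have hr := congrArg Polynomial.roots key
  rwa [Polynomial.roots_multiset_prod_X_sub_C, Polynomial.roots_multiset_prod_X_sub_C] at hr

/-- `DetRescue 3` holds (from `det_rescue_rank_three`, discarding the unused hypotheses).
[folklore] -/
theorem detRescue_three : DetRescue 3 :=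
  fun X X' S S' hX _ hS _ h0 _ h1 h2 hdet _ => det_rescue_rank_three X X' S S' hX hS h0 h1 h2 hdet

/-- The rank-4 core of the counterexample: `X₄ = {1,-1,6,-6}` and `S₄ = {2,-2,3,-3}` are both
`(-1)`-symmetric, so with partners `X' = S₄`, `S' = X₄` the two identities hold trivially, and
`det = 36` on both sides; yet `X₄ ≠ S₄`. [folklore] -/
theorem rank_four_symmetric_swap :
    ({1, -1, 6, -6} : Multiset ℂ) + ({2, -2, 3, -3} : Multiset ℂ).map ((-1 : ℂ) * ·) =
      ({2, -2, 3, -3} : Multiset ℂ) + ({1, -1, 6, -6} : Multiset ℂ).map ((-1 : ℂ) * ·) ∧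
    ({1, -1, 6, -6} : Multiset ℂ).prod = ({2, -2, 3, -3} : Multiset ℂ).prod ∧
    ({1, -1, 6, -6} : Multiset ℂ) ≠ {2, -2, 3, -3} := by
  refine ⟨?_, ?_, ?_⟩
  · have hm1 : (({2, -2, 3, -3} : Multiset ℂ).map ((-1 : ℂ) * ·)) = {-2, 2, -3, 3} := by
      simp [Multiset.insert_eq_cons]
    have hm2 : (({1, -1, 6, -6} : Multiset ℂ).map ((-1 : ℂ) * ·)) = {-1, 1, -6, 6} := by
      simp [Multiset.insert_eq_cons]
    rw [hm1, hm2]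
    simp only [Multiset.insert_eq_cons, ← Multiset.singleton_add]
    abel
  · simp [Multiset.insert_eq_cons]; norm_num
  · intro h
    have : (1 : ℂ) ∈ ({2, -2, 3, -3} : Multiset ℂ) := by rw [← h]; simp
    simp only [Multiset.insert_eq_cons, Multiset.mem_cons, Multiset.mem_singleton] at this
    norm_num at this

/-- **The determinant rescue fails from rank 4 on.** Pad the rank-4 symmetric swap with `n - 4`
common eigenvalues `7`: all hypotheses of `DetRescue n` hold (non-zero entries, both identities,
both determinants) and `X ≠ S`. So "all quadratic twists + central character" — the device of
Berger–Harcos §6 / Mok Prop. 5.13 at `n = 2` — cannot replace a twist of ratio order `> n` in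
the crux's cofinite step once `n ≥ 4`. [folklore] -/
theorem not_detRescue_of_four_le {n : ℕ} (hn : 4 ≤ n) : ¬ DetRescue n := by
  intro h
  obtain ⟨hid, hprod, hne⟩ := rank_four_symmetric_swap
  set X₄ : Multiset ℂ := {1, -1, 6, -6} with hX₄
  set S₄ : Multiset ℂ := {2, -2, 3, -3} with hS₄
  set T : Multiset ℂ := Multiset.replicate (n - 4) (7 : ℂ) with hT
  have hTc : card T = n - 4 := by simp [hT]
  have hc : ∀ M : Multiset ℂ, card M = 4 → card (M + T) = n := by
    intro M hM; rw [card_add, hM, hTc]; omega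
  have hX₄c : card X₄ = 4 := by simp [hX₄]
  have hS₄c : card S₄ = 4 := by simp [hS₄]
  have h0T : (0 : ℂ) ∉ T := by simp [hT, Multiset.mem_replicate]
  have h0X : (0 : ℂ) ∉ X₄ + T := by
    rw [Multiset.mem_add, not_or]; refine ⟨?_, h0T⟩; simp [hX₄]
  have h0S : (0 : ℂ) ∉ S₄ + T := by
    rw [Multiset.mem_add, not_or]; refine ⟨?_, h0T⟩; simp [hS₄]
  have hid' : X₄ + T + (S₄ + T).map ((-1 : ℂ) * ·) = S₄ + T + (X₄ + T).map ((-1 : ℂ) * ·) := by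
    rw [Multiset.map_add, Multiset.map_add, ← add_assoc, ← add_assoc,
      add_right_comm X₄ T, hid, add_right_comm S₄ T]
  have hp : (X₄ + T).prod = (S₄ + T).prod := by
    rw [Multiset.prod_add, Multiset.prod_add, hprod]
  have key := h (X₄ + T) (S₄ + T) (S₄ + T) (X₄ + T) (hc _ hX₄c) (hc _ hS₄c) (hc _ hS₄c)
    (hc _ hX₄c) h0X h0S (add_comm _ _) hid' hp hp.symm
  apply hne
  -- strip the common padding
  have := congrArg (fun M => M - T) key
  simpa using this

/-- In particular `DetRescue 4` is false (the first rank beyond the rescue). [folklore] -/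
theorem not_detRescue_four : ¬ DetRescue 4 := not_detRescue_of_four_le le_rfl

/-! ## Purity does not help: a unit-norm rank-4 witness -/

section Pure

open Complex

local notation "𝑢" => ((3 + 4 * I) / 5 : ℂ)
local notation "𝑣" => ((4 + 3 * I) / 5 : ℂ)

/-- `(3+4i)/5 · (4+3i)/5 = i`. [folklore] -/
theorem pure_uv : 𝑢 * 𝑣 = I := by field_simp; ring_nf; simp

/-- `‖(3+4i)/5‖ = 1`. [folklore] -/
theorem norm_pureU : ‖𝑢‖ = 1 := by
  rw [norm_div]
  have : ‖(3 + 4 * I : ℂ)‖ = 5 := by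
    rw [Complex.norm_eq_sqrt_sq_add_sq]; norm_num
  rw [this]; norm_num

/-- `‖(4+3i)/5‖ = 1`. [folklore] -/
theorem norm_pureV : ‖𝑣‖ = 1 := by
  rw [norm_div]
  have : ‖(4 + 3 * I : ℂ)‖ = 5 := by
    rw [Complex.norm_eq_sqrt_sq_add_sq]; norm_num
  rw [this]; norm_num

/-- **Pure rank-4 swap.** `X = {±1, ±i}` and `S = {±(3+4i)/5, ±(4+3i)/5}` are `(-1)`-symmetric
unit-norm `4`-multisets with equal determinant `-1` and `X ≠ S`. [folklore] -/
theorem rank_four_pure_swap :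
    (({1, -1, I, -I} : Multiset ℂ).map ((-1 : ℂ) * ·) = {1, -1, I, -I}) ∧
    (({𝑢, -𝑢, 𝑣, -𝑣} : Multiset ℂ).map ((-1 : ℂ) * ·) = {𝑢, -𝑢, 𝑣, -𝑣}) ∧
    ({1, -1, I, -I} : Multiset ℂ).prod = ({𝑢, -𝑢, 𝑣, -𝑣} : Multiset ℂ).prod ∧
    (∀ z ∈ ({1, -1, I, -I} : Multiset ℂ) + {𝑢, -𝑢, 𝑣, -𝑣}, ‖z‖ = 1) ∧
    ({1, -1, I, -I} : Multiset ℂ) ≠ {𝑢, -𝑢, 𝑣, -𝑣} := by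
  refine ⟨?_, ?_, ?_, ?_, ?_⟩
  · simp [Multiset.insert_eq_cons]
    simp only [← Multiset.singleton_add]
    abel
  · simp [Multiset.insert_eq_cons]
    simp only [← Multiset.singleton_add]
    abel
  · simp only [Multiset.insert_eq_cons, Multiset.prod_cons, Multiset.prod_singleton]
    linear_combination (-(𝑢 * 𝑣 + I)) * pure_uv
  · intro z hz
    simp only [Multiset.mem_add, Multiset.insert_eq_cons, Multiset.mem_cons,
      Multiset.mem_singleton] at hz
    rcases hz with (rfl | rfl | rfl | rfl) | (rfl | rfl | rfl | rfl)
    · simp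
    · simp
    · simp
    · simp
    · exact norm_pureU
    · rw [norm_neg]; exact norm_pureU
    · exact norm_pureV
    · rw [norm_neg]; exact norm_pureV
  · intro h
    have h1 : (1 : ℂ) ∈ ({𝑢, -𝑢, 𝑣, -𝑣} : Multiset ℂ) := by rw [← h]; simp
    simp only [Multiset.insert_eq_cons, Multiset.mem_cons, Multiset.mem_singleton] at h1
    rcases h1 with h1 | h1 | h1 | h1 <;>
    · have := congrArg Complex.im h1
      norm_num at this

/-- **`DetRescue 4` fails even for PURE data** (all eigenvalues of norm `1`, as for the unitary
Satake parameters of a cuspidal `π` under Ramanujan, or Weil numbers of a fixed weight after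
normalisation): witness `rank_four_pure_swap` with partners `X' = S`, `S' = X`. [folklore] -/
theorem not_detRescue_four_pure :
    ∃ X X' S S' : Multiset ℂ, card X = 4 ∧ card X' = 4 ∧ card S = 4 ∧ card S' = 4 ∧
      (∀ z ∈ X + S, ‖z‖ = 1) ∧ (0 : ℂ) ∉ X ∧ (0 : ℂ) ∉ S ∧
      X + X' = S + S' ∧ X + X'.map ((-1 : ℂ) * ·) = S + S'.map ((-1 : ℂ) * ·) ∧
      X.prod = S.prod ∧ X'.prod = S'.prod ∧ X ≠ S := by
  obtain ⟨hX, hS, hprod, hnorm, hne⟩ := rank_four_pure_swap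
  refine ⟨{1, -1, I, -I}, {𝑢, -𝑢, 𝑣, -𝑣}, {𝑢, -𝑢, 𝑣, -𝑣}, {1, -1, I, -I}, by simp, by simp,
    by simp, by simp, hnorm, ?_, ?_, add_comm _ _, ?_, hprod, hprod.symm, hne⟩
  · intro h0
    have := hnorm 0 (Multiset.mem_add.2 (Or.inl h0))
    simp at this
  · intro h0
    have := hnorm 0 (Multiset.mem_add.2 (Or.inr h0))
    simp at this
  · rw [hS, hX, add_comm]

end Pure

end Summit.Langlands.Langlands.Theorems.TwistUnpackaging.Negative
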